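import Summits.Ventures.Crystal3D.Theorems.StickyWulffConstantGenericWallFloorRayPushWeak
import Summits.Ventures.Crystal3D.Theorems.StickyWulffConstantGenericWallFloorChainFramesWords
import Summits.Ventures.Crystal3D.Theorems.StickyWulffConstantGenericWallFloorDoubleTopLocalFrame
import HarnessLib

/-!
# The ℚ-MIRROR of the forced ray in LOCAL (model) coordinates and its transfer (crux `GenericWallFloor`,
# stmt-Ventures-19480, line `WallLedgerG`; milestone M1 of the in-kernel tail datum, cf-p1 (lxxxvi))

HONEST FRAMING. Venture `Summits/Ventures/Crystal3D` (cell `crystal3d-full`), helper `--supports` the crux `GenericWallFloor`.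
Rung credit only; census-free, standard axioms; F-C1 not moved.

THE LOCAL RECURSION.  Along the forced ray `e_j = forcedTop z ⟨A, u, 0⟩ n j` (frame `F_j`, direction slot `d_j`, entry normal
`N_{j−1}`, `N_{−1} = n`) put `ℓ_j := F_{j−1}⁻¹ N_{j−1}` (`F_{−1} = A`) — the LETTERS of the ray word
(`rayWord z ⟨A,u,0⟩ n (m+1) = [ℓ_m, …, ℓ_0]`) — and `Z_j := F_j⁻¹ z` (the steering seen from level `j`).  Then (model vectors, no
cubic coordinates needed): `F_j⁻¹ N_{j−1} = −ℓ_j` (`symm_twinFrame_self`), `d_j` is a slot with `⟪d_j, ℓ_j⟫ < 0` maximising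
`⟪·, Z_j⟫` among such slots (`bestCapper_spec` pulled back through the isometry `F_j`), `ℓ_{j+1} = ℓ_j + 2√(2/3)·d_j` and
`Z_{j+1} = R_{ℓ_{j+1}} Z_j` (`forcedTop_local_step`).  In cubic NUMERATORS (`L = √3·κ(ℓ) ∈ {±1}³`, `D = √2·κ(d) ∈ slotNums`,
`Z ∝ κ(Z_j)`) this is integer/rational: `D ∈ capperSet L Z`, `L' = L + 2D`, `Z' = reflNum L' Z`.
* `slotNums`, `reflNum`, `capperSet`, **`rayBranches Zc L Z K`** — the finite list of ALL letter sequences `[L_1, …, L_K]` the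
  recursion can produce from `(L, Z)` in `K` steps (every tie branch kept); decidable data over `ℚ`.
* **`exists_rayBranch`** (TRANSFER) — for a real steering `z` with `κ(A⁻¹z) = t • Zc` (`t > 0`, `Zc` rational), a slot `u` and an
  admissible first normal `n` with letter numerator `L₀ ∈ {±1}³`: the numerators of the letters `ℓ_1, …, ℓ_K` of the real forced ray
  form ONE element of `rayBranches Zc L₀ (reflNum L₀ Zc) K`.  Hence every 5-letter word the tree's walker can read is among finitely many
  computable candidates — the rows «W_F» of the tail certificate become checkable DATA (sequel: string form + table).
WHAT THIS IS NOT: the table itself; not the stub; F-C1 not moved.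
-/

noncomputable section

namespace Summit.Ventures.Crystal3D.Theorems

open Summit.Ventures.Crystal3D Finset Matrix
open scoped InnerProductSpace

/-! ### The local step along the real forced ray -/

/-- **One level of the forced ray in LOCAL coordinates.**  Level `j` with frame `F`, entry normal `N` (unit menu normal of `F`):
the direction `d = bestCapper F N z` is a slot with `⟪d, F⁻¹N⟫ = √(2/3)` maximising `⟪·, F⁻¹z⟫` over such slots; the next letter
`ℓ' := F⁻¹(nextNormal)` is `2√(2/3)·d − F⁻¹N`; the next frame pulls back `nextNormal` to `−ℓ'` and `z` to `R_{ℓ'}(F⁻¹z)`. -/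
theorem forcedTop_local_step (z : EuclideanSpace ℝ (Fin 3)) (e : WalkEntry) (hν : ‖e.nrm‖ = 1)
    (hmenu : ∀ w ∈ fccSlots, ⟪e.frame w, e.nrm⟫_ℝ = 0 ∨ ⟪e.frame w, e.nrm⟫_ℝ = Real.sqrt (2 / 3) ∨
      ⟪e.frame w, e.nrm⟫_ℝ = -Real.sqrt (2 / 3))
    (hdir : e.dir = bestCapper e.frame e.nrm z) :
    e.dir ∈ fccSlots ∧ ⟪e.dir, e.frame.symm e.nrm⟫_ℝ = Real.sqrt (2 / 3) ∧
      (∀ q ∈ fccSlots, 0 < ⟪q, e.frame.symm e.nrm⟫_ℝ → ⟪q, e.frame.symm z⟫_ℝ ≤ ⟪e.dir, e.frame.symm z⟫_ℝ) ∧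
      e.frame.symm (nextNormal e) = (2 * Real.sqrt (2 / 3)) • e.dir - e.frame.symm e.nrm ∧
      (pushEntry z e (nextNormal e)).frame.symm (nextNormal e) = -e.frame.symm (nextNormal e) ∧
      (pushEntry z e (nextNormal e)).frame.symm z =
        (ℝ ∙ e.frame.symm (nextNormal e))ᗮ.reflection (e.frame.symm z) := by
  classical
  have hr : 0 < Real.sqrt (2 / 3) := Real.sqrt_pos.2 (by norm_num)
  have hloc : ∀ q x : EuclideanSpace ℝ (Fin 3), ⟪e.frame q, x⟫_ℝ = ⟪q, e.frame.symm x⟫_ℝ := fun q x => by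
    rw [← LinearIsometryEquiv.inner_map_map e.frame q (e.frame.symm x), LinearIsometryEquiv.apply_symm_apply]
  obtain ⟨p, hp, hpn, -⟩ := exists_pos_slot_ne e.frame hν hmenu 0
  have hne : (fccSlots.filter fun q => 0 < ⟪e.frame q, e.nrm⟫_ℝ).Nonempty := ⟨p, Finset.mem_filter.2 ⟨hp, by rw [hpn]; exact hr⟩⟩
  obtain ⟨hmem, hmax⟩ := bestCapper_spec e.frame e.nrm z hne
  rw [← hdir, Finset.mem_filter] at hmem
  obtain ⟨hd, hdpos⟩ := hmem
  have hdval : ⟪e.frame e.dir, e.nrm⟫_ℝ = Real.sqrt (2 / 3) := by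
    rcases hmenu e.dir hd with h | h | h
    · rw [h] at hdpos; exact absurd hdpos (lt_irrefl 0)
    · exact h
    · rw [h] at hdpos; linarith
  have hN1 : ‖nextNormal e‖ = 1 := (nextNormal_unit_menu hdir hν hmenu).1
  refine ⟨hd, by rw [← hloc]; exact hdval, fun q hq hqpos => ?_, ?_, ?_, ?_⟩
  · have h := hmax q (Finset.mem_filter.2 ⟨hq, by rw [hloc]; exact hqpos⟩)
    rw [← hdir, hloc, hloc] at h
    exact h
  · rw [nextNormal, map_sub, LinearIsometryEquiv.map_smul, LinearIsometryEquiv.symm_apply_apply]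
  · exact symm_twinFrame_self e.frame hN1
  · show (twinFrame e.frame (nextNormal e)).symm z = _
    have hF' : ∀ x, twinFrame e.frame (nextNormal e) x = e.frame x - (2 * ⟪e.frame x, nextNormal e⟫_ℝ) • nextNormal e :=
      twinFrame_apply e.frame hN1
    have hm1 : ‖e.frame.symm (nextNormal e)‖ = 1 := by rw [LinearIsometryEquiv.norm_map, hN1]
    apply (twinFrame e.frame (nextNormal e)).injective
    rw [LinearIsometryEquiv.apply_symm_apply, hF', reflection_unit_apply hm1, map_sub, LinearIsometryEquiv.map_smul,
      LinearIsometryEquiv.apply_symm_apply, LinearIsometryEquiv.apply_symm_apply, inner_sub_left, real_inner_smul_left,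
      ← hloc, LinearIsometryEquiv.apply_symm_apply, real_inner_self_eq_norm_sq, hN1]
    simp only [one_pow, mul_one]
    module

/-! ### The ℚ-mirror -/

/-- The numerator `√2·κ(slotSite k)` of the `k`-th slot, as a rational vector (`NearIdentity.slotInt`). -/
def slotNum (k : Fin 12) : Fin 3 → ℚ := fun i => (NearIdentity.slotInt k i : ℚ)

/-- The twelve slot numerators: all `(±1,±1,0)` and permutations. -/
def slotNums : List (Fin 3 → ℚ) := List.ofFn slotNum

/-- Reflection of numerators in a letter numerator `L` (`L·L = 3`): `v ↦ v − (2/3)(v·L) L`. -/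
def reflNum (L v : Fin 3 → ℚ) : Fin 3 → ℚ :=
  v - (2 / 3 * (v ⬝ᵥ L)) • L

/-- The admissible cappers at local data `(L, Z)`: slot numerators `Q` with `Q·L < 0` maximising `Q·Z` among those. -/
def capperSet (L Z : Fin 3 → ℚ) : List (Fin 3 → ℚ) :=
  slotNums.filter fun Q => Q ⬝ᵥ L < 0 ∧ ∀ Q' ∈ slotNums, Q' ⬝ᵥ L < 0 → Q' ⬝ᵥ Z ≤ Q ⬝ᵥ Z

/-- **All letter sequences of length `K`** the local recursion can produce from `(L, Z)` (every tie branch kept):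
`D ∈ capperSet L Z`, `L' = L + 2D`, `Z' = reflNum L' Z`. -/
def rayBranches : (Fin 3 → ℚ) → (Fin 3 → ℚ) → ℕ → List (List (Fin 3 → ℚ))
  | _, _, 0 => [[]]
  | L, Z, K + 1 => (capperSet L Z).flatMap fun D =>
      (rayBranches (L + (2 : ℚ) • D) (reflNum (L + (2 : ℚ) • D) Z) K).map fun rest => (L + (2 : ℚ) • D) :: rest

/-- Membership in `rayBranches …  (K + 1)`, unfolded. -/
theorem mem_rayBranches_succ {L Z : Fin 3 → ℚ} {K : ℕ} {Ls : List (Fin 3 → ℚ)} :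
    Ls ∈ rayBranches L Z (K + 1) ↔ ∃ D ∈ capperSet L Z, ∃ rest ∈ rayBranches (L + (2 : ℚ) • D) (reflNum (L + (2 : ℚ) • D) Z) K,
      Ls = (L + (2 : ℚ) • D) :: rest := by
  simp only [rayBranches, List.mem_flatMap, List.mem_map]
  constructor
  · rintro ⟨D, hD, rest, hrest, rfl⟩; exact ⟨D, hD, rest, hrest, rfl⟩
  · rintro ⟨D, hD, rest, hrest, rfl⟩; exact ⟨D, hD, rest, hrest, rfl⟩

/-! ### Cubic numerators of model vectors -/

/-- Casting a rational vector to a real one, componentwise. -/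
def castVec (v : Fin 3 → ℚ) : Fin 3 → ℝ := fun i => (v i : ℝ)

/-- `castVec` is additive. -/
theorem castVec_add (v w : Fin 3 → ℚ) : castVec (v + w) = castVec v + castVec w := by
  ext i; simp [castVec]

/-- `castVec` commutes with scalars. -/
theorem castVec_smul (r : ℚ) (v : Fin 3 → ℚ) : castVec (r • v) = (r : ℝ) • castVec v := by
  ext i; simp [castVec]

/-- `castVec` turns rational dot products into real ones. -/
theorem castVec_dotProduct (v w : Fin 3 → ℚ) : castVec v ⬝ᵥ castVec w = ((v ⬝ᵥ w : ℚ) : ℝ) := by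
  simp [castVec, dotProduct, Fin.sum_univ_three]

/-- `castVec` of `reflNum`. -/
theorem castVec_reflNum (L v : Fin 3 → ℚ) :
    castVec (reflNum L v) = castVec v - ((2 / 3 : ℝ) * (castVec v ⬝ᵥ castVec L)) • castVec L := by
  rw [reflNum, show v - (2 / 3 * (v ⬝ᵥ L)) • L = v + (-(2 / 3 * (v ⬝ᵥ L))) • L by rw [neg_smul, sub_eq_add_neg],
    castVec_add, castVec_smul, castVec_dotProduct]
  push_cast
  rw [neg_smul, sub_eq_add_neg]

/-- The cubic coordinates of a slot are `(√2)⁻¹ •` its numerator. -/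
theorem cubicCoords_slotSite_eq_castVec (k : Fin 12) : cubicCoords (slotSite k) = (Real.sqrt 2)⁻¹ • castVec (slotNum k) := by
  rw [cubicCoords_slotSite]
  ext i
  simp [castVec, slotNum, NearIdentity.slotVec, div_eq_mul_inv, mul_comm]

/-- Every slot has a numerator in `slotNums`: `cubicCoords w = (√2)⁻¹ • castVec Q`. -/
theorem exists_slotNum_of_mem_fccSlots {w : EuclideanSpace ℝ (Fin 3)} (hw : w ∈ fccSlots) :
    ∃ Q ∈ slotNums, cubicCoords w = (Real.sqrt 2)⁻¹ • castVec Q := by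
  obtain ⟨k, rfl⟩ := exists_slotSite_eq hw
  exact ⟨slotNum k, by rw [slotNums, List.mem_ofFn]; exact ⟨k, rfl⟩, cubicCoords_slotSite_eq_castVec k⟩

/-- Every numerator in `slotNums` is the numerator of a slot. -/
theorem exists_slot_of_mem_slotNums {Q : Fin 3 → ℚ} (hQ : Q ∈ slotNums) :
    ∃ w ∈ fccSlots, cubicCoords w = (Real.sqrt 2)⁻¹ • castVec Q := by
  rw [slotNums, List.mem_ofFn] at hQ
  obtain ⟨k, rfl⟩ := hQ
  exact ⟨slotSite k, slotSite_mem k, cubicCoords_slotSite_eq_castVec k⟩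

/-! ### Numerator bookkeeping -/

/-- Pull-back through a twin frame: `(twinFrame G m)⁻¹ x = R_{G⁻¹m} (G⁻¹ x)`. -/
theorem symm_twinFrame_apply (G : EuclideanSpace ℝ (Fin 3) ≃ₗᵢ[ℝ] EuclideanSpace ℝ (Fin 3)) {m : EuclideanSpace ℝ (Fin 3)}
    (hm : ‖m‖ = 1) (x : EuclideanSpace ℝ (Fin 3)) :
    (twinFrame G m).symm x = (ℝ ∙ G.symm m)ᗮ.reflection (G.symm x) := by
  have hF' : ∀ y, twinFrame G m y = G y - (2 * ⟪G y, m⟫_ℝ) • m := twinFrame_apply G hm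
  have hm1 : ‖G.symm m‖ = 1 := by rw [LinearIsometryEquiv.norm_map, hm]
  have hloc : ∀ q y : EuclideanSpace ℝ (Fin 3), ⟪G q, y⟫_ℝ = ⟪q, G.symm y⟫_ℝ := fun q y => by
    rw [← LinearIsometryEquiv.inner_map_map G q (G.symm y), LinearIsometryEquiv.apply_symm_apply]
  apply (twinFrame G m).injective
  rw [LinearIsometryEquiv.apply_symm_apply, hF', reflection_unit_apply hm1, map_sub, LinearIsometryEquiv.map_smul,
    LinearIsometryEquiv.apply_symm_apply, LinearIsometryEquiv.apply_symm_apply, inner_sub_left, real_inner_smul_left,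
    ← hloc, LinearIsometryEquiv.apply_symm_apply, real_inner_self_eq_norm_sq, hm]
  simp only [one_pow, mul_one]
  module

/-- **Cubic numerators of a model reflection**: if `κ(y) = t·Z` and `√3·κ(μ) = M` (`μ` a unit vector) then
`κ(R_μ y) = t · reflNum M Z`. -/
theorem cubicCoords_reflection_numerator {μ y : EuclideanSpace ℝ (Fin 3)} (hμ : ‖μ‖ = 1) {t : ℝ} {Z M : Fin 3 → ℚ}
    (hy : cubicCoords y = t • castVec Z) (hM : castVec M = Real.sqrt 3 • cubicCoords μ) :
    cubicCoords ((ℝ ∙ μ)ᗮ.reflection y) = t • castVec (reflNum M Z) := by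
  obtain ⟨-, hs3, -, hs3p, -⟩ := sqrt_two_three_facts
  have hμ' : cubicCoords μ = (Real.sqrt 3)⁻¹ • castVec M := by
    rw [hM, smul_smul, inv_mul_cancel₀ hs3p.ne', one_smul]
  have h3 : (Real.sqrt 3)⁻¹ * (Real.sqrt 3)⁻¹ = 1 / 3 := by rw [← mul_inv, hs3]; norm_num
  rw [reflection_unit_apply hμ, cubicCoords_sub, cubicCoords_smul, inner_eq_cubicCoords, hy, hμ', smul_dotProduct,
    dotProduct_smul, smul_smul, castVec_reflNum, smul_sub, smul_smul]
  ext i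
  simp only [Pi.sub_apply, Pi.smul_apply, smul_eq_mul]
  linear_combination (-(2 * t * (castVec Z ⬝ᵥ castVec M) * castVec M i)) * h3

/-! ### The transfer -/

section Transfer

variable {A : EuclideanSpace ℝ (Fin 3) ≃ₗᵢ[ℝ] EuclideanSpace ℝ (Fin 3)} {u n z : EuclideanSpace ℝ (Fin 3)}
  {t : ℝ}

/-- **Transfer, all levels from level `j`.**  If level `j` of the forced ray has local entry normal with numerator `−L`
(`castVec L = −√3·κ(F_j⁻¹N_{j−1})`) and local steering `κ(F_j⁻¹z) = t·Z` (`t > 0`), then the numerators of the next `K` letters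
`√3·κ(F_{j+i}⁻¹ N_{j+i})`, `i < K`, form an element of `rayBranches L Z K`. -/
theorem exists_rayBranch_from (hn : ‖n‖ = 1)
    (hmenu : ∀ w ∈ fccSlots, ⟪A w, n⟫_ℝ = 0 ∨ ⟪A w, n⟫_ℝ = Real.sqrt (2 / 3) ∨ ⟪A w, n⟫_ℝ = -Real.sqrt (2 / 3))
    (ht : 0 < t) :
    ∀ (K j : ℕ) (L Z : Fin 3 → ℚ),
      castVec L = -(Real.sqrt 3 • cubicCoords ((forcedTop z ⟨A, u, 0⟩ n j).frame.symm (forcedTop z ⟨A, u, 0⟩ n j).nrm)) →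
      cubicCoords ((forcedTop z ⟨A, u, 0⟩ n j).frame.symm z) = t • castVec Z →
      ∃ Ls ∈ rayBranches L Z K, Ls.map castVec = (List.range K).map fun i =>
        Real.sqrt 3 • cubicCoords ((forcedTop z ⟨A, u, 0⟩ n (j + i)).frame.symm (nextNormal (forcedTop z ⟨A, u, 0⟩ n (j + i))))
  | 0, j, L, Z, _, _ => ⟨[], by simp [rayBranches], by simp⟩
  | K + 1, j, L, Z, hL, hZ => by
    obtain ⟨hs2, hs3, hs2p, hs3p, h23⟩ := sqrt_two_three_facts
    set e := forcedTop z ⟨A, u, 0⟩ n j with he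
    obtain ⟨hν, hmenuj, -⟩ := forcedTop_chain_invariant z A u hn hmenu j
    rw [← he] at hν hmenuj
    obtain ⟨hd, hdpos, hmax, hnext, hnrm', hz'⟩ := forcedTop_local_step z e hν hmenuj (forcedTop_dir z ⟨A, u, 0⟩ n j)
    have hN1 : ‖nextNormal e‖ = 1 := (nextNormal_unit_menu (forcedTop_dir z ⟨A, u, 0⟩ n j) hν hmenuj).1
    -- numerators of the local normal, the direction and the local steering
    have hlam : cubicCoords (e.frame.symm e.nrm) = -((Real.sqrt 3)⁻¹ • castVec L) := by
      rw [hL, smul_neg, smul_smul, inv_mul_cancel₀ hs3p.ne', one_smul, neg_neg]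
    obtain ⟨D, hDmem, hD⟩ := exists_slotNum_of_mem_fccSlots hd
    have h6 : 0 < (Real.sqrt 2)⁻¹ * (Real.sqrt 3)⁻¹ := by positivity
    -- inner products against the local normal in numerators: `⟪q, λ⟫ = −(Q·L)/(√2√3)`
    have hinn : ∀ {q : EuclideanSpace ℝ (Fin 3)} {Q : Fin 3 → ℚ}, cubicCoords q = (Real.sqrt 2)⁻¹ • castVec Q →
        ⟪q, e.frame.symm e.nrm⟫_ℝ = -((Real.sqrt 2)⁻¹ * (Real.sqrt 3)⁻¹) * (((Q ⬝ᵥ L : ℚ) : ℝ)) := by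
      intro q Q hq
      rw [inner_eq_cubicCoords, hq, hlam, smul_dotProduct, dotProduct_neg, dotProduct_smul, castVec_dotProduct, smul_eq_mul,
        smul_eq_mul]
      ring
    have hinz : ∀ {q : EuclideanSpace ℝ (Fin 3)} {Q : Fin 3 → ℚ}, cubicCoords q = (Real.sqrt 2)⁻¹ • castVec Q →
        ⟪q, e.frame.symm z⟫_ℝ = ((Real.sqrt 2)⁻¹ * t) * (((Q ⬝ᵥ Z : ℚ) : ℝ)) := by
      intro q Q hq
      rw [inner_eq_cubicCoords, hq, hZ, smul_dotProduct, dotProduct_smul, castVec_dotProduct, smul_eq_mul, smul_eq_mul]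
      ring
    -- `D ∈ capperSet L Z`
    have hDcap : D ∈ capperSet L Z := by
      rw [capperSet, List.mem_filter, decide_eq_true_eq]
      refine ⟨hDmem, ?_, fun Q' hQ' hQ'L => ?_⟩
      · have h1 := hinn hD
        rw [hdpos] at h1
        have hr : 0 < Real.sqrt (2 / 3) := Real.sqrt_pos.2 (by norm_num)
        have h2 : ((Real.sqrt 2)⁻¹ * (Real.sqrt 3)⁻¹) * (((D ⬝ᵥ L : ℚ) : ℝ)) < 0 := by linarith
        have h3 : (((D ⬝ᵥ L : ℚ) : ℝ)) < 0 := by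
          by_contra hge; push Not at hge
          exact absurd h2 (not_lt.2 (mul_nonneg h6.le hge))
        exact_mod_cast h3
      · obtain ⟨q, hq, hqc⟩ := exists_slot_of_mem_slotNums hQ'
        have hqpos : 0 < ⟪q, e.frame.symm e.nrm⟫_ℝ := by
          rw [hinn hqc]
          have : (((Q' ⬝ᵥ L : ℚ) : ℝ)) < 0 := by exact_mod_cast hQ'L
          nlinarith
        have h := hmax q hq hqpos
        rw [hinz hqc, hinz hD] at h
        have hc : 0 < (Real.sqrt 2)⁻¹ * t := by positivity
        exact_mod_cast le_of_mul_le_mul_left h hc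
    -- the next letter `ℓ' = 2√(2/3) d − λ` has numerator `L + 2D`
    have hℓ' : castVec (L + (2 : ℚ) • D) = Real.sqrt 3 • cubicCoords (e.frame.symm (nextNormal e)) := by
      rw [hnext, cubicCoords_sub, cubicCoords_smul, hD, hlam, castVec_add, castVec_smul]
      have h23' : Real.sqrt 3 * (2 * Real.sqrt (2 / 3)) * (Real.sqrt 2)⁻¹ = 2 := by
        rw [h23]; field_simp
      rw [smul_sub, smul_smul, smul_smul, h23', smul_neg, smul_smul, mul_inv_cancel₀ hs3p.ne', one_smul, sub_neg_eq_add]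
      push_cast
      rw [add_comm]
    -- level `j + 1` data
    have hfr : (forcedTop z ⟨A, u, 0⟩ n (j + 1)).frame = (pushEntry z e (nextNormal e)).frame := rfl
    have hnr : (forcedTop z ⟨A, u, 0⟩ n (j + 1)).nrm = nextNormal e := rfl
    have hL' : castVec (L + (2 : ℚ) • D) =
        -(Real.sqrt 3 • cubicCoords ((forcedTop z ⟨A, u, 0⟩ n (j + 1)).frame.symm (forcedTop z ⟨A, u, 0⟩ n (j + 1)).nrm)) := by
      rw [hfr, hnr, hnrm', cubicCoords_neg, smul_neg, neg_neg, hℓ']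
    have hZ' : cubicCoords ((forcedTop z ⟨A, u, 0⟩ n (j + 1)).frame.symm z) = t • castVec (reflNum (L + (2 : ℚ) • D) Z) := by
      rw [hfr, hz']
      have hm1 : ‖e.frame.symm (nextNormal e)‖ = 1 := by rw [LinearIsometryEquiv.norm_map, hN1]
      exact cubicCoords_reflection_numerator hm1 hZ hℓ'
    obtain ⟨rest, hrest, hmap⟩ := exists_rayBranch_from hn hmenu ht K (j + 1) _ _ hL' hZ'
    refine ⟨(L + (2 : ℚ) • D) :: rest, mem_rayBranches_succ.2 ⟨D, hDcap, rest, hrest, rfl⟩, ?_⟩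
    rw [List.map_cons, List.range_succ_eq_map, List.map_cons, List.map_map, hmap, Nat.add_zero, hℓ']
    congr 1
    apply List.map_congr_left
    intro i _
    simp only [Function.comp_apply]
    rw [show j + (i + 1) = j + 1 + i by omega]

/-- **TRANSFER from the bottom.**  Base frame `A`, slot `u`, admissible unit menu normal `n` with letter numerator `L₀`
(`castVec L₀ = √3·κ(A⁻¹n)`), steering `z` with `κ(A⁻¹z) = t·Zc` (`t > 0`, `Zc` rational).  Then for every `K` the numerators of the
letters `ℓ_1, …, ℓ_K` (`ℓ_{i+1} = F_i⁻¹ N_i`) of the forced ray `forcedTop z ⟨A, u, 0⟩ n ·` form an element of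
`rayBranches L₀ (reflNum L₀ Zc) K` — a finite, computable set containing every tie branch. -/
theorem exists_rayBranch (hn : ‖n‖ = 1)
    (hmenu : ∀ w ∈ fccSlots, ⟪A w, n⟫_ℝ = 0 ∨ ⟪A w, n⟫_ℝ = Real.sqrt (2 / 3) ∨ ⟪A w, n⟫_ℝ = -Real.sqrt (2 / 3))
    {Zc L₀ : Fin 3 → ℚ} (hZ : cubicCoords (A.symm z) = t • castVec Zc) (ht : 0 < t)
    (hL₀ : castVec L₀ = Real.sqrt 3 • cubicCoords (A.symm n)) (K : ℕ) :
    ∃ Ls ∈ rayBranches L₀ (reflNum L₀ Zc) K, Ls.map castVec = (List.range K).map fun i =>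
      Real.sqrt 3 • cubicCoords ((forcedTop z ⟨A, u, 0⟩ n i).frame.symm (nextNormal (forcedTop z ⟨A, u, 0⟩ n i))) := by
  have hfr : (forcedTop z ⟨A, u, 0⟩ n 0).frame = twinFrame A n := rfl
  have hnr : (forcedTop z ⟨A, u, 0⟩ n 0).nrm = n := rfl
  have hL : castVec L₀ =
      -(Real.sqrt 3 • cubicCoords ((forcedTop z ⟨A, u, 0⟩ n 0).frame.symm (forcedTop z ⟨A, u, 0⟩ n 0).nrm)) := by
    rw [hfr, hnr, symm_twinFrame_self A hn, cubicCoords_neg, smul_neg, neg_neg, hL₀]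
  have hZ0 : cubicCoords ((forcedTop z ⟨A, u, 0⟩ n 0).frame.symm z) = t • castVec (reflNum L₀ Zc) := by
    rw [hfr, symm_twinFrame_apply A hn]
    exact cubicCoords_reflection_numerator (by rw [LinearIsometryEquiv.norm_map, hn]) hZ hL₀
  have h := exists_rayBranch_from (u := u) hn hmenu ht K 0 L₀ (reflNum L₀ Zc) hL hZ0
  simpa only [Nat.zero_add] using h

end Transfer

end Summit.Ventures.Crystal3D.Theorems

end
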